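import Summits.ResolutionOfSingularities.ResolutionOfSingularities.Theorems.FrobeniusLadderFInjectiveMacaulayficationReductions
import Literature.AlgebraicGeometry.Resolution.Macaulayfication

/-!
# Crux `FInjectiveMacaulayfication`: the open core in INTEGRAL form (line `Sketch`, cycle-6 reshape)

Support file for crux `stmt-ResolutionOfSingularities-15315` (`FrobeniusLadder.FInjectiveMacaulayfication`, route
`ResolutionOfSingularities/FrobeniusLadder`, rung 2), line `Sketch`.

Up to cycle 5 the skeleton composed Kawasaki's Macaulayfication (glued over the components, locally integral
output) with the open stub `stub_fInjectivize`, whose input is a separated finite-type `X₁/k` with Cohen–Macaulay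
DOMAIN stalks. Since the crux is equivalent to its integral form
(`Reductions.fInjectiveMacaulayfication_iff_integral`) and Kawasaki's output over an integral `X` is integral, the
lead of cycle 6 reshaped the open core to INTEGRAL input — `stub_fInjectivizeIntegral`: for `p` prime, `k` a field
of characteristic `p` and `X₁/k` INTEGRAL separated of finite type with all local rings Cohen–Macaulay, there is a
proper birational `X' → X₁` whose stalks are Cohen–Macaulay domains with Frobenius closed parameter ideals. This
file certifies the reshape, sorry-free:

* `stubFInjectivizeIntegral_of_stubFInjectivize` — the old stub implies the new one (an integral scheme has domain
  stalks): the new open core is WEAKER;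
* `stubFInjectivizeIntegral_of_fInjectiveMacaulayfication` — the crux implies the new stub outright (an integral
  scheme is reduced);
* `fInjectiveMacaulayfication_of_kawasaki_of_stubFInjectivizeIntegral` — Kawasaki's theorem (the Literature named
  fact `KawasakiMacaulayfication`, universe `0`) and the new stub imply the crux: reduce to integral `X`, Macaulayfy,
  F-injectivize, compose (the top model is integral, being birational over the integral `X₁` with domain stalks);
  this is the cycle-6 skeleton `Cruxes/FInjectiveMacaulayfication/Lines/Sketch.lean` as an implication;
* `fInjectiveMacaulayfication_iff_stubFInjectivizeIntegral` — hence, modulo Kawasaki, the new stub IS the crux;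
  `stub_integralCoreCertificate` is its registered `∀`-form.

References: T. Kawasaki, Trans. AMS 352 (2000), Thm. 1.1; K. Česnavičius, arXiv:1810.04493, Thm. 1.6. [folklore]
-/

-- single-problem summit: the doubled namespace component is forced
set_option linter.dupNamespace false

noncomputable section

namespace Summit.ResolutionOfSingularities.ResolutionOfSingularities.Theorems.FInjectiveMacaulayfication.IntegralCore

open AlgebraicGeometry CategoryTheory Literature.AlgebraicGeometry.Resolution
open Summit.ResolutionOfSingularities.ResolutionOfSingularities.Theses.FrobeniusLadder

/-- **The old open core implies the reshaped one.** If every separated finite-type `X₁/k` with Cohen–Macaulay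
domain stalks can be F-injectivized (the stub `stub_fInjectivize` of cycles 1–5, signature verbatim), then so can
every INTEGRAL separated finite-type `X₁/k` with Cohen–Macaulay local rings (the stub `stub_fInjectivizeIntegral`
of cycle 6, signature verbatim): the stalks of an integral scheme are domains. [folklore] -/
theorem stubFInjectivizeIntegral_of_stubFInjectivize
    (h : ∀ (p : ℕ), p.Prime → ∀ (k : Type) [Field k] [CharP k p] (X₁ : Scheme.{0})
      (f₁ : X₁ ⟶ Spec (.of k)), IsSeparated f₁ → LocallyOfFiniteType f₁ → QuasiCompact f₁ →
      (∀ x : X₁, IsDomain (X₁.presheaf.stalk x) ∧ ∀ d : ℕ, ringKrullDim (X₁.presheaf.stalk x) = d →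
        ∀ s : Fin d → X₁.presheaf.stalk x, (Ideal.span (Set.range s)).radical.IsMaximal →
          RingTheory.Sequence.IsWeaklyRegular (X₁.presheaf.stalk x) (List.ofFn s)) →
      ∃ (X' : Scheme.{0}) (π : X' ⟶ X₁), IsProper π ∧ IsBirational π ∧ ∀ x : X',
        IsDomain (X'.presheaf.stalk x) ∧ ∀ d : ℕ, ringKrullDim (X'.presheaf.stalk x) = d →
          ∀ s : Fin d → X'.presheaf.stalk x, (Ideal.span (Set.range s)).radical.IsMaximal →
            RingTheory.Sequence.IsWeaklyRegular (X'.presheaf.stalk x) (List.ofFn s) ∧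
            ∀ y : X'.presheaf.stalk x, (∃ e : ℕ, y ^ p ^ e ∈ Ideal.span
              ((fun z : X'.presheaf.stalk x => z ^ p ^ e) ''
                (Ideal.span (Set.range s) : Set (X'.presheaf.stalk x)))) →
              y ∈ Ideal.span (Set.range s)) :
    ∀ (p : ℕ), p.Prime → ∀ (k : Type) [Field k] [CharP k p]
      (X₁ : Scheme.{0}) (f₁ : X₁ ⟶ Spec (.of k)), IsSeparated f₁ → LocallyOfFiniteType f₁ → QuasiCompact f₁ →
      IsIntegral X₁ →
      (∀ x : X₁, ∀ d : ℕ, ringKrullDim (X₁.presheaf.stalk x) = d →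
        ∀ s : Fin d → X₁.presheaf.stalk x, (Ideal.span (Set.range s)).radical.IsMaximal →
          RingTheory.Sequence.IsWeaklyRegular (X₁.presheaf.stalk x) (List.ofFn s)) →
      ∃ (X' : Scheme.{0}) (π : X' ⟶ X₁), IsProper π ∧ IsBirational π ∧
        ∀ x : X', IsDomain (X'.presheaf.stalk x) ∧ ∀ d : ℕ, ringKrullDim (X'.presheaf.stalk x) = d →
          ∀ s : Fin d → X'.presheaf.stalk x, (Ideal.span (Set.range s)).radical.IsMaximal →
            RingTheory.Sequence.IsWeaklyRegular (X'.presheaf.stalk x) (List.ofFn s) ∧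
            ∀ y : X'.presheaf.stalk x, (∃ e : ℕ, y ^ p ^ e ∈
                Ideal.span ((fun z : X'.presheaf.stalk x => z ^ p ^ e) ''
                  (Ideal.span (Set.range s) : Set (X'.presheaf.stalk x)))) →
              y ∈ Ideal.span (Set.range s) := by
  intro p hp k _ _ X₁ f₁ hsep hft hqc hint hCM
  exact h p hp k X₁ f₁ hsep hft hqc fun x => ⟨inferInstance, hCM x⟩

/-- **The crux implies the reshaped open core outright**: an integral separated finite-type `k`-scheme is
reduced, so the crux applies to it and yields exactly the conclusion of `stub_fInjectivizeIntegral` (the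
Cohen–Macaulay hypothesis is not consumed). The statement after the colon is the registered stub signature
verbatim. [folklore] -/
theorem stubFInjectivizeIntegral_of_fInjectiveMacaulayfication (h : FInjectiveMacaulayfication) :
    ∀ (p : ℕ), p.Prime → ∀ (k : Type) [Field k] [CharP k p]
      (X₁ : Scheme.{0}) (f₁ : X₁ ⟶ Spec (.of k)), IsSeparated f₁ → LocallyOfFiniteType f₁ → QuasiCompact f₁ →
      IsIntegral X₁ →
      (∀ x : X₁, ∀ d : ℕ, ringKrullDim (X₁.presheaf.stalk x) = d →
        ∀ s : Fin d → X₁.presheaf.stalk x, (Ideal.span (Set.range s)).radical.IsMaximal →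
          RingTheory.Sequence.IsWeaklyRegular (X₁.presheaf.stalk x) (List.ofFn s)) →
      ∃ (X' : Scheme.{0}) (π : X' ⟶ X₁), IsProper π ∧ IsBirational π ∧
        ∀ x : X', IsDomain (X'.presheaf.stalk x) ∧ ∀ d : ℕ, ringKrullDim (X'.presheaf.stalk x) = d →
          ∀ s : Fin d → X'.presheaf.stalk x, (Ideal.span (Set.range s)).radical.IsMaximal →
            RingTheory.Sequence.IsWeaklyRegular (X'.presheaf.stalk x) (List.ofFn s) ∧
            ∀ y : X'.presheaf.stalk x, (∃ e : ℕ, y ^ p ^ e ∈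
                Ideal.span ((fun z : X'.presheaf.stalk x => z ^ p ^ e) ''
                  (Ideal.span (Set.range s) : Set (X'.presheaf.stalk x)))) →
              y ∈ Ideal.span (Set.range s) := by
  intro p hp k _ _ X₁ f₁ hsep hft hqc hint _
  exact h p hp k X₁ f₁ hsep hft hqc inferInstance

/-- **Kawasaki's Macaulayfication and the reshaped open core together imply the crux** — the cycle-6
skeleton of line `Sketch` as an implication: by `fInjectiveMacaulayfication_iff_integral` it suffices to treat
integral `X`; Macaulayfy (`hK`: proper birational `X₁ → X`, `X₁` integral with Cohen–Macaulay local rings),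
F-injectivize (`hF`), and compose — proper ∘ proper is proper, birational ∘ birational is birational
(`ComponentGluing.IsBirational.comp`), and the top model is integral because it is birational over the integral
`X₁` with domain stalks (`isIntegral_of_isBirational_of_isDomain_stalk`). `hK` is the Literature named fact
`KawasakiMacaulayfication` (Kawasaki 2000, Thm. 1.1; Česnavičius 2021, Thm. 1.6) at universe `0`; `hF` is the
registered stub signature verbatim. [cite: Kawasaki2000, Thm 1.1] -/
theorem fInjectiveMacaulayfication_of_kawasaki_of_stubFInjectivizeIntegral
    (hK : KawasakiMacaulayfication.{0})
    (hF : ∀ (p : ℕ), p.Prime → ∀ (k : Type) [Field k] [CharP k p]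
      (X₁ : Scheme.{0}) (f₁ : X₁ ⟶ Spec (.of k)), IsSeparated f₁ → LocallyOfFiniteType f₁ → QuasiCompact f₁ →
      IsIntegral X₁ →
      (∀ x : X₁, ∀ d : ℕ, ringKrullDim (X₁.presheaf.stalk x) = d →
        ∀ s : Fin d → X₁.presheaf.stalk x, (Ideal.span (Set.range s)).radical.IsMaximal →
          RingTheory.Sequence.IsWeaklyRegular (X₁.presheaf.stalk x) (List.ofFn s)) →
      ∃ (X' : Scheme.{0}) (π : X' ⟶ X₁), IsProper π ∧ IsBirational π ∧
        ∀ x : X', IsDomain (X'.presheaf.stalk x) ∧ ∀ d : ℕ, ringKrullDim (X'.presheaf.stalk x) = d →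
          ∀ s : Fin d → X'.presheaf.stalk x, (Ideal.span (Set.range s)).radical.IsMaximal →
            RingTheory.Sequence.IsWeaklyRegular (X'.presheaf.stalk x) (List.ofFn s) ∧
            ∀ y : X'.presheaf.stalk x, (∃ e : ℕ, y ^ p ^ e ∈
                Ideal.span ((fun z : X'.presheaf.stalk x => z ^ p ^ e) ''
                  (Ideal.span (Set.range s) : Set (X'.presheaf.stalk x)))) →
              y ∈ Ideal.span (Set.range s)) :
    FInjectiveMacaulayfication := by
  refine fInjectiveMacaulayfication_iff_integral.mpr ?_
  intro p hp k _ _ X f hsep hft hqc hint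
  obtain ⟨X₁, π₁, hπ₁, hbir₁, hint₁, hCM⟩ := hK k X f hsep hft hqc hint
  haveI := hπ₁
  haveI := hsep
  haveI := hft
  haveI := hqc
  have hsep₁ : IsSeparated (π₁ ≫ f) := inferInstance
  have hft₁ : LocallyOfFiniteType (π₁ ≫ f) := inferInstance
  have hqc₁ : QuasiCompact (π₁ ≫ f) := inferInstance
  obtain ⟨X', π, hπ, hbir, hgood⟩ := hF p hp k X₁ (π₁ ≫ f) hsep₁ hft₁ hqc₁ hint₁ hCM
  haveI := hπ
  haveI := hint₁
  exact ⟨X', π ≫ π₁, inferInstance, ComponentGluing.IsBirational.comp hbir hbir₁,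
    isIntegral_of_isBirational_of_isDomain_stalk (ComponentGluing.IsBirational.comp hbir hbir₁)
      fun x => (hgood x).1, hgood⟩

/-- **Modulo Kawasaki's theorem the reshaped open core IS the crux**: `stub_fInjectivizeIntegral ↔ crux` under the
named fact `KawasakiMacaulayfication` — the certificate that the cycle-6 skeleton of line `Sketch` bottoms out at a
crux-sized stub, now with INTEGRAL Cohen–Macaulay input (the form in which a blow-up engine certified chartwise,
E6/E7, applies). [cite: Kawasaki2000, Thm 1.1] -/
theorem fInjectiveMacaulayfication_iff_stubFInjectivizeIntegral (hK : KawasakiMacaulayfication.{0}) :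
    FInjectiveMacaulayfication ↔
      ∀ (p : ℕ), p.Prime → ∀ (k : Type) [Field k] [CharP k p]
        (X₁ : Scheme.{0}) (f₁ : X₁ ⟶ Spec (.of k)), IsSeparated f₁ → LocallyOfFiniteType f₁ → QuasiCompact f₁ →
        IsIntegral X₁ →
        (∀ x : X₁, ∀ d : ℕ, ringKrullDim (X₁.presheaf.stalk x) = d →
          ∀ s : Fin d → X₁.presheaf.stalk x, (Ideal.span (Set.range s)).radical.IsMaximal →
            RingTheory.Sequence.IsWeaklyRegular (X₁.presheaf.stalk x) (List.ofFn s)) →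
        ∃ (X' : Scheme.{0}) (π : X' ⟶ X₁), IsProper π ∧ IsBirational π ∧
          ∀ x : X', IsDomain (X'.presheaf.stalk x) ∧ ∀ d : ℕ, ringKrullDim (X'.presheaf.stalk x) = d →
            ∀ s : Fin d → X'.presheaf.stalk x, (Ideal.span (Set.range s)).radical.IsMaximal →
              RingTheory.Sequence.IsWeaklyRegular (X'.presheaf.stalk x) (List.ofFn s) ∧
              ∀ y : X'.presheaf.stalk x, (∃ e : ℕ, y ^ p ^ e ∈
                  Ideal.span ((fun z : X'.presheaf.stalk x => z ^ p ^ e) ''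
                    (Ideal.span (Set.range s) : Set (X'.presheaf.stalk x)))) →
                y ∈ Ideal.span (Set.range s) :=
  ⟨stubFInjectivizeIntegral_of_fInjectiveMacaulayfication,
    fInjectiveMacaulayfication_of_kawasaki_of_stubFInjectivizeIntegral hK⟩

/-- **Registered certificate form** (helper stub `stub_integralCoreCertificate`, the `∀`-form of
`fInjectiveMacaulayfication_iff_stubFInjectivizeIntegral` — everything after the colon, so that the gate can match
it by name and signature): `KawasakiMacaulayfication.{0} → (crux ↔ stub_fInjectivizeIntegral)`.
[cite: Kawasaki2000, Thm 1.1] -/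
theorem stub_integralCoreCertificate :
    Literature.AlgebraicGeometry.Resolution.KawasakiMacaulayfication.{0} →
      (Summit.ResolutionOfSingularities.ResolutionOfSingularities.Theses.FrobeniusLadder.FInjectiveMacaulayfication ↔
        ∀ (p : ℕ), p.Prime → ∀ (k : Type) [Field k] [CharP k p]
          (X₁ : Scheme.{0}) (f₁ : X₁ ⟶ Spec (.of k)), IsSeparated f₁ → LocallyOfFiniteType f₁ → QuasiCompact f₁ →
          IsIntegral X₁ →
          (∀ x : X₁, ∀ d : ℕ, ringKrullDim (X₁.presheaf.stalk x) = d →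
            ∀ s : Fin d → X₁.presheaf.stalk x, (Ideal.span (Set.range s)).radical.IsMaximal →
              RingTheory.Sequence.IsWeaklyRegular (X₁.presheaf.stalk x) (List.ofFn s)) →
          ∃ (X' : Scheme.{0}) (π : X' ⟶ X₁), IsProper π ∧ Literature.AlgebraicGeometry.Resolution.IsBirational π ∧
            ∀ x : X', IsDomain (X'.presheaf.stalk x) ∧ ∀ d : ℕ, ringKrullDim (X'.presheaf.stalk x) = d →
              ∀ s : Fin d → X'.presheaf.stalk x, (Ideal.span (Set.range s)).radical.IsMaximal →
                RingTheory.Sequence.IsWeaklyRegular (X'.presheaf.stalk x) (List.ofFn s) ∧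
                ∀ y : X'.presheaf.stalk x, (∃ e : ℕ, y ^ p ^ e ∈
                    Ideal.span ((fun z : X'.presheaf.stalk x => z ^ p ^ e) ''
                      (Ideal.span (Set.range s) : Set (X'.presheaf.stalk x)))) →
                  y ∈ Ideal.span (Set.range s)) :=
  fInjectiveMacaulayfication_iff_stubFInjectivizeIntegral

end Summit.ResolutionOfSingularities.ResolutionOfSingularities.Theorems.FInjectiveMacaulayfication.IntegralCore

end
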